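import Literature.Topology.FourManifolds.MMSWPictureCover
import Literature.Topology.FourManifolds.KnotGroupTubular
import Literature.Geometry.Manifold.SmoothEmbeddingInverse
import Literature.Geometry.Manifold.OpenEmbeddingCriterion
import HarnessLib

/-!
# Gluing data from a surgery presentation with round tubes

Topic `Literature/Topology/FourManifolds`; part of the proof of the named fact
`Literature.Topology.FourManifolds.pictureSurgeryPresentation` (`MMSWPictureSurgery.lean`; Kirby,
*The Topology of 4-Manifolds*, LNM 1374 (1989), Ch. I §2, Lemma 2.1).  Everything here is proved;
no named fact is introduced.

From a surgery presentation of `Y` on the link `U_1 ∪ ⋯ ∪ U_k ∪ K'` (`U_j` the dotted circles,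
`K' = P ∘ K` the picture of the model knot `K ⊆ M_k`) whose tubes about the dotted circles are the
thin round `0`-framed tubes of `MMSWPictureDottedTubes` (possibly reflected) and whose tube `ν'`
about `K'` has image inside the good region `Olast k η` of the picture, we construct the gluing
data `MMSW.Gluing k η Y` of `MMSWPictureGluing` (`gluingOf`): `JA`, `JB` are the given embeddings
extended by junk values, `JAinv`, `JBinv` their inverses, `LC` the link complement, `KC` the model
knot in complex coordinates and `T' = ν'`.

## References

* R. Kirby, *The Topology of 4-Manifolds*, LNM 1374 (1989), Ch. I §2. [Kirby1989]
-/

open scoped Manifold ContDiff Topology Real ComplexConjugate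
open Function Set Metric Filter

noncomputable section

namespace Literature.Topology.FourManifolds

/-- Local notation: `𝔼 n` is the model Euclidean space `EuclideanSpace ℝ (Fin n)`. -/
local notation "𝔼 " n:arg => EuclideanSpace ℝ (Fin n)
/-- Local notation: `𝕊 n` is the unit sphere of `EuclideanSpace ℝ (Fin (n + 1))`. -/
local notation "𝕊 " n:arg => (Metric.sphere (0 : EuclideanSpace ℝ (Fin (n + 1))) 1)

namespace MMSW

open Literature.AlgebraicTopology.Homotopy.HopfFibration (zC wC ofZW zC_ofZW wC_ofZW ofZW_zC_wC)

variable {k : ℕ} {η : ℝ}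

/-! ## The good region of the picture for the tube of the last component -/

/-- **The good region** `Olast`: sphere points off the north pole whose chart point lies in the
picture region with `|w|² > 3η` for the chart lift. [folklore] -/
def Olast (k : ℕ) (η : ℝ) : Set (𝕊 3) :=
  {a | a ≠ northPole ∧ stereoNorthCoords (a : 𝔼 4) ∈ pictureRegion k ∧
    3 * η < ‖wC (chartLift k (stereoNorthCoords (a : 𝔼 4)))‖ ^ 2}

/-- The good region is open. [folklore] -/
theorem isOpen_Olast : IsOpen (Olast k η) := by
  rw [isOpen_iff_mem_nhds]
  intro a ha
  obtain ⟨hN, hreg, hw⟩ := ha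
  have hσ : ContinuousAt (fun a : 𝕊 3 ↦ stereoNorthCoords (a : 𝔼 4)) a :=
    (contDiffAt_stereoNorthCoords (apply_three_ne_one_of_ne_northPole hN)).continuousAt.comp
      continuous_subtype_val.continuousAt
  have h1 : {a : 𝕊 3 | a ≠ northPole} ∈ 𝓝 a := isOpen_ne.mem_nhds hN
  have h2 : {a : 𝕊 3 | stereoNorthCoords (a : 𝔼 4) ∈ pictureRegion k} ∈ 𝓝 a :=
    hσ.preimage_mem_nhds (isOpen_pictureRegion.mem_nhds hreg)
  have h3 : {a : 𝕊 3 | 3 * η < ‖wC (chartLift k (stereoNorthCoords (a : 𝔼 4)))‖ ^ 2} ∈ 𝓝 a := by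
    have hc : ContinuousAt (fun a : 𝕊 3 ↦ ‖wC (chartLift k (stereoNorthCoords (a : 𝔼 4)))‖ ^ 2) a := by
      have h1 : ContinuousAt (fun a : 𝕊 3 ↦ chartLift k (stereoNorthCoords (a : 𝔼 4))) a :=
        ContinuousAt.comp (f := fun a : 𝕊 3 ↦ stereoNorthCoords (a : 𝔼 4)) (x := a)
          (contDiffAt_chartLift hreg).continuousAt hσ
      exact (((contDiff_wC (n := ∞)).continuous.continuousAt.comp h1).norm).pow 2
    exact hc.preimage_mem_nhds (Ioi_mem_nhds hw)
  filter_upwards [h1, h2, h3] with b hb1 hb2 hb3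
  exact ⟨hb1, hb2, hb3⟩

/-- A point of the good region, lifted to the model, in complex coordinates. [folklore] -/
theorem lift_of_mem_Olast (hη : 0 < η) {a : 𝕊 3} (ha : a ∈ Olast k η) :
    (zC (chartLift k (stereoNorthCoords (a : 𝔼 4))), wC (chartLift k (stereoNorthCoords (a : 𝔼 4)))) ∈ Mset k ∧
    wC (chartLift k (stereoNorthCoords (a : 𝔼 4))) ≠ 0 ∧
    planarPot k (zC (chartLift k (stereoNorthCoords (a : 𝔼 4)))) < 1 - 3 * η ∧
    virtS k η (zC (chartLift k (stereoNorthCoords (a : 𝔼 4))), wC (chartLift k (stereoNorthCoords (a : 𝔼 4)))) = a := by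
  obtain ⟨hN, hreg, hw⟩ := ha
  set y := stereoNorthCoords (a : 𝔼 4)
  set X := chartLift k y
  have hM : (zC X, wC X) ∈ Mset k := (mem_Mset_iff X).2 (chartLift_mem_modelBoundary hreg)
  have hw0 : wC X ≠ 0 := wC_chartLift_ne_zero hreg
  have hg : planarPot k (zC X) < 1 - 3 * η := by
    have := hM.2; simp only at this; linarith
  refine ⟨hM, hw0, hg, ?_⟩
  have hχ : cutoff η (planarPot k (zC X)) = 0 := cutoff_eq_zero hη (by linarith)
  have hzmod : zmod k η (zC X, wC X) = zC X :=
    zmod_of_cutoff_eq_zero hχ (norm_fst_lt_drawRadius_of_mem hM)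
  rw [virtS, virtC, hzmod]
  show stereoNorthInv (cpt k (zC X) (conj (unitDir 0 (wC X)))) = a
  rw [← draw_eq_cpt, draw_chartLift hreg, stereoNorthInv_stereoNorthCoords hN]

/-- Dotted circles avoid the good region. [folklore] -/
theorem dottedCircle_not_mem_Olast (j : Fin k) (θ : 𝕊 1) : dottedCircle k j θ ∉ Olast k η := by
  rintro ⟨-, hreg, -⟩
  rw [dottedCircle_eq_stereoNorthInv_cpt, coe_stereoNorthInv, stereoNorthCoords_stereoNorthInvCoe] at hreg
  have := hreg.2.1 j
  rw [chartZ_cpt (by rw [norm_toC, norm_eq_of_mem_sphere]) (by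
    simp only [holeCentre, Complex.ofReal_re]
    have := drawRadius_pos' (k := k); positivity), sub_self, map_zero] at this
  linarith

/-! ## The model knot and its picture -/

section ModelKnot

variable {K : (𝕊 1) → 𝔼 4}

/-- The picture `P(x) = σ_N⁻¹ (draw x)` of a point of the model. [folklore] -/
theorem stereoNorthInv_draw_eq_virtS (hη : 0 < η) {x : 𝔼 4} (hx : x ∈ modelBoundary k)
    (hg : planarPot k (zC x) ≤ 1 - 3 * η / 2) :
    stereoNorthInv (draw k x) = virtS k η (zC x, wC x) := by
  have hM : (zC x, wC x) ∈ Mset k := (mem_Mset_iff x).2 hx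
  have hzmod : zmod k η (zC x, wC x) = zC x :=
    zmod_of_cutoff_eq_zero (cutoff_eq_zero hη hg) (norm_fst_lt_drawRadius_of_mem hM)
  rw [virtS, virtC, hzmod, draw_eq_cpt]

end ModelKnot

/-! ## The extended embeddings -/

section Extend

variable {Y : Type*} {ι : Type*} [Finite ι] {L : Link ι}

open Classical in
/-- The embedding of the link complement, extended by a junk value. [folklore] -/
def extA (jA : L.complement → Y) (y₀ : Y) (a : 𝕊 3) : Y :=
  if h : a ∈ L.complement then jA ⟨a, h⟩ else y₀

/-- On the complement the extension is the embedding. [folklore] -/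
theorem extA_of_mem (jA : L.complement → Y) (y₀ : Y) {a : 𝕊 3} (h : a ∈ L.complement) :
    extA jA y₀ a = jA ⟨a, h⟩ := by
  classical
  exact dif_pos h

/-- On the complement (subtype form). [folklore] -/
@[simp] theorem extA_coe (jA : L.complement → Y) (y₀ : Y) (a : L.complement) :
    extA jA y₀ (a : 𝕊 3) = jA a := by rw [extA_of_mem jA y₀ a.2]

/-- The base circle point. [folklore] -/
def baseS : 𝕊 1 := circlePoint 0

/-- The embedding of a solid torus, extended by junk values. [folklore] -/
def extB (jB : solidTorus → Y) (q : (𝔼 2) × (𝕊 1)) : Y :=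
  if h : ‖q.1‖ < 1 then jB ⟨q, (mem_solidTorus_iff q).2 h⟩
  else jB ⟨(0, q.2), by rw [mem_solidTorus_iff, norm_zero]; exact one_pos⟩

/-- On the open solid torus the extension is the embedding. [folklore] -/
theorem extB_of_lt (jB : solidTorus → Y) {q : (𝔼 2) × (𝕊 1)} (h : ‖q.1‖ < 1) :
    extB jB q = jB ⟨q, (mem_solidTorus_iff q).2 h⟩ := dif_pos h

/-- On the solid torus (subtype form). [folklore] -/
@[simp] theorem extB_coe (jB : solidTorus → Y) (b : solidTorus) :
    extB jB (b : (𝔼 2) × (𝕊 1)) = jB b := by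
  rw [extB_of_lt jB ((mem_solidTorus_iff _).1 b.2)]

/-- The extension takes values in the range of `jB`. [folklore] -/
theorem extB_mem_range (jB : solidTorus → Y) (q : (𝔼 2) × (𝕊 1)) : extB jB q ∈ range jB := by
  unfold extB; split_ifs <;> exact ⟨_, rfl⟩

end Extend

/-! ## Chart points of the picture are far from the axis circle in latitude -/

/-- Chart points with the same planar point and direction coincide: the planar point is read off.
[folklore] -/
theorem fst_eq_of_cpt_eq {z z' u u' : ℂ} (hu : ‖u‖ = 1) (hu' : ‖u'‖ = 1) (hz : 0 ≤ z.re + drawRadius k)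
    (hz' : 0 ≤ z'.re + drawRadius k) (h : cpt k z u = cpt k z' u') : z = z' := by
  rw [← chartZ_cpt (k := k) hu hz, ← chartZ_cpt (k := k) hu' hz', h]

/-- Planar points of the blob have latitude `≥ c_k`. [folklore] -/
theorem latC_le_latS_of_norm_le {z : ℂ} (hz : ‖z‖ ≤ 40 * ((k : ℝ) + 1)) : latC k ≤ latS k z := by
  rw [← normSq_le_bigRadius_sq_iff_latC, Complex.normSq_eq_norm_sq, bigRadius]
  have hk : (0 : ℝ) ≤ 40 * ((k : ℝ) + 1) := by positivity
  nlinarith [norm_nonneg z]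

/-- A point of the blob has `Re z + C_k > 0`. [folklore] -/
theorem re_add_drawRadius_pos_of_norm_le {z : ℂ} (hz : ‖z‖ ≤ 40 * ((k : ℝ) + 1)) :
    0 < z.re + drawRadius k := by
  have := Complex.abs_re_le_norm z
  have := neg_abs_le z.re
  have hk : (0 : ℝ) ≤ k := Nat.cast_nonneg k
  unfold drawRadius; linarith

/-- **An outer core point is never a picture point of the blob**: for `q` in the outer core zone
and `z` with `|z| ≤ 40(k+1)`, `|u| = 1`, `outS q ≠ σ_N⁻¹ (cpt z u)` (`0 < η`). [folklore] -/
theorem outS_ne_stereoNorthInv_cpt (hη : 0 < η) {q : ℂ × ℂ} (hq : q ∈ zoneO k η) {z u : ℂ}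
    (hz : ‖z‖ ≤ 40 * ((k : ℝ) + 1)) (hu : ‖u‖ = 1) : outS k q ≠ stereoNorthInv (cpt k z u) := by
  have hk : (0 : ℝ) ≤ k := Nat.cast_nonneg k
  have hre := re_add_drawRadius_pos_of_norm_le hz
  intro h
  by_cases hw : q.2 = 0
  · -- core point: vanishing planar coordinates
    obtain ⟨h0, h1⟩ := outS_core_apply hq hw
    rw [h, coe_stereoNorthInv, stereoNorthInvCoe_apply_zero, div_eq_zero_iff] at h0
    rw [h, coe_stereoNorthInv, stereoNorthInvCoe_apply_one, div_eq_zero_iff] at h1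
    have hr := stereoNorthRadSq_add_one_pos (cpt k z u)
    have h0' : (cpt k z u).1.1 = 0 := by rcases h0 with h0 | h0 <;> linarith
    have h1' : (cpt k z u).1.2 = 0 := by rcases h1 with h1 | h1 <;> linarith
    have hprod : (((z.re + drawRadius k : ℝ) : ℂ)) * u = 0 := by
      apply Complex.ext
      · simpa [cpt] using h0'
      · simpa [cpt] using h1'
    rcases mul_eq_zero.1 hprod with h' | h'
    · have : z.re + drawRadius k = 0 := by exact_mod_cast h'
      linarith
    · rw [← norm_eq_zero, hu] at h'; exact one_ne_zero h'
  · -- off the core: the outer core point is the virtual point, of latitude `ρ(|w|) < 1/2`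
    have hzq : ‖q.1‖ < drawRadius k := by unfold drawRadius; linarith [hq.2.1]
    rw [← virtS_eq_outS hη hq.1.le hzq hq.2.2.2.le hw, virtS] at h
    have hc : virtC k η q = cpt k z u := stereoNorthInvCoe_injective (by
      have := congrArg (fun a : 𝕊 3 ↦ (a : 𝔼 4)) h
      simpa only [coe_stereoNorthInv] using this)
    obtain ⟨hzmod, hF0⟩ := zmod_of_far_eq_outerZ (η := η) hq.1.le hzq hw
    set F := cutoff η (planarPot k q.1) * thinRad ‖q.2‖ +
      (1 - cutoff η (planarPot k q.1)) * latS k q.1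
    have hχ : cutoff η (planarPot k q.1) = 1 := cutoff_eq_one hη hq.2.2.2.le
    have hF : F = thinRad ‖q.2‖ := by
      show cutoff η (planarPot k q.1) * thinRad ‖q.2‖ +
        (1 - cutoff η (planarPot k q.1)) * latS k q.1 = thinRad ‖q.2‖
      rw [hχ]; ring
    have hρ := thinRad_lt_half ‖q.2‖
    have hco : coLat k q.1 ≠ 0 := coLat_ne_zero_of_mem_zoneO hq
    have he : ‖coLatDir k q.1‖ = 1 := norm_coLatDir hco
    have hF1 : F ≤ 1 := by rw [hF]; linarith
    -- the virtual planar point and its latitude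
    have hreZ : 0 ≤ (zmod k η q).re + drawRadius k := by
      rw [hzmod, outerZ_re, sub_add_cancel]
      exact (div_pos (mul_pos focal_pos hF0) (one_sub_sqrt_mul_pos hF0 he.le)).le
    have hζ : zmod k η q = z :=
      fst_eq_of_cpt_eq (by rw [Complex.norm_conj, norm_unitDir hw]) hu hreZ hre.le hc
    have hlat : latS k (zmod k η q) = F := by rw [hzmod]; exact latS_outerZ he hF0 hF1
    have := latC_le_latS_of_norm_le hz
    have hc1 := lt_latC (k := k)
    rw [← hζ, hlat, hF] at this
    linarith

/-- **The virtual planar point of a point of `M_k` off the cores is never a pole**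
(`0 < η ≤ 1/40`). [folklore] -/
theorem zmod_ne_holeCentre (hη : 0 < η) (hη' : η ≤ 1 / 40) {p : ℂ × ℂ} (hp : p ∈ Mset k) (hw : p.2 ≠ 0)
    (j : Fin k) : zmod k η p ≠ holeCentre k j := by
  have hk : (0 : ℝ) ≤ k := Nat.cast_nonneg k
  intro h
  by_cases hχ : cutoff η (planarPot k p.1) = 0
  · rw [zmod_of_cutoff_eq_zero hχ (norm_fst_lt_drawRadius_of_mem hp)] at h
    exact ne_holeCentre_of_mem hp j h
  · have hg := lt_of_cutoff_ne_zero hη hχ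
    have h1920 : 19 / 20 ≤ planarPot k p.1 := by linarith
    rcases far_or_near_of_le_planarPot h1920 with hfar | ⟨i, hi⟩
    · rw [bigRadius] at hfar
      have hge := le_norm_zmod_of_far hη hη' hp (by linarith) hw
      rw [h] at hge
      have := norm_holeCentre_le (r := k) j
      linarith
    · have hann : p.1 ∈ annulus (holeCentre k i) (1 / 2) (27 / 20) := ⟨by linarith [hp.1 i], hi⟩
      obtain ⟨h0, hlt⟩ := norm_zmod_sub_holeCentre (η := η) hann hw
      rw [h] at h0 hlt
      by_cases hij : j = i
      · subst hij; simp at h0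
      · have := four_le_norm_holeCentre_sub (k := k) hij
        linarith

/-! ## The gluing data -/

section Data

variable {Y : Type} [TopologicalSpace Y] [ChartedSpace (𝔼 3) Y] [IsManifold (𝓡 3) ∞ Y]
  {K : (𝕊 1) → 𝔼 4} {L : Link (Fin (k + 1))}
  {νL : ∀ i, Knot.TubularNbhd (L.component i)}
  {jA : L.complement → Y} {jB : Fin (k + 1) → solidTorus → Y} {fl : Fin k → Bool}

/-- Membership in the link complement, component by component. [folklore] -/
theorem mem_complement_iff' (hLj : ∀ j : Fin k, ⇑(L.component j.castSucc) = dottedCircle k j)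
    (hLlast : ∀ t, L.component (Fin.last k) t = stereoNorthInv (draw k (K t))) (a : 𝕊 3) :
    a ∈ L.complement ↔ (∀ (j : Fin k) (θ : 𝕊 1), a ≠ dottedCircle k j θ) ∧
      ∀ t, a ≠ stereoNorthInv (draw k (K t)) := by
  rw [Link.mem_complement_iff, Fin.forall_fin_succ']
  refine and_congr (forall_congr' fun j ↦ ?_) ?_
  · rw [hLj j]
    exact ⟨fun h θ hθ ↦ h ⟨θ, hθ.symm⟩, fun h ⟨θ, hθ⟩ ↦ h θ hθ.symm⟩
  · constructor
    · intro h t ht; exact h ⟨t, by rw [hLlast, ht]⟩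
    · rintro h ⟨t, ht⟩; exact h t (by rw [← ht, hLlast])

/-- **The punctured thin tube of a dotted circle lies in the link complement.** [folklore] -/
theorem dottedTubeFun_mem_complement (hKM : ∀ t, K t ∈ modelBoundary k) (hKw : ∀ t, wC (K t) ≠ 0)
    (hLj : ∀ j : Fin k, ⇑(L.component j.castSucc) = dottedCircle k j)
    (hLlast : ∀ t, L.component (Fin.last k) t = stereoNorthInv (draw k (K t)))
    (hνj : ∀ (j : Fin k) (q : (𝕊 1) × (𝔼 2)), νL j.castSucc q = dottedTubeFun k j (q.1, flipE (fl j) q.2))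
    (j : Fin k) (u : 𝕊 1) {v : 𝔼 2} (hv : v ≠ 0) : dottedTubeFun k j (u, v) ∈ L.complement := by
  rw [mem_complement_iff' hLj hLlast]
  refine ⟨fun i θ h ↦ ?_, fun t h ↦ ?_⟩
  · by_cases hij : i = j
    · subst hij
      have hmem := (νL i.castSucc).apply_mem_compl_range (x := u) (w := flipE (fl i) v)
        (by rw [← norm_ne_zero_iff, norm_flipE, norm_ne_zero_iff]; exact hv)
      rw [hνj, flipE_flipE, hLj, h] at hmem
      exact hmem ⟨θ, rfl⟩
    · have h1 : dottedCircle k i θ ∈ range (dottedTubeFun k i) := by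
        have := (νL i.castSucc).coe_apply_zero θ
        rw [hνj, hLj] at this
        refine ⟨(θ, flipE (fl i) 0), ?_⟩
        simpa using this
      exact Set.disjoint_left.1 (disjoint_range_dottedTubeFun (Ne.symm hij)) ⟨_, rfl⟩ (h ▸ h1)
  · have hnot := approxMap_zero_notMem_range_dottedTubeFun j (hKM t) (hKw t)
    rw [approxMap_zero, toSphereThree_eq_stereoNorthInv] at hnot
    exact hnot ⟨_, h⟩

/-- **The punctured tube of the last component lies in the link complement.** [folklore] -/
theorem tubeLast_mem_complement (hLj : ∀ j : Fin k, ⇑(L.component j.castSucc) = dottedCircle k j)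
    (hLlast : ∀ t, L.component (Fin.last k) t = stereoNorthInv (draw k (K t)))
    (hν' : range (νL (Fin.last k)) ⊆ Olast k η) (u : 𝕊 1) {v : 𝔼 2} (hv : v ≠ 0) :
    νL (Fin.last k) (u, v) ∈ L.complement := by
  rw [mem_complement_iff' hLj hLlast]
  refine ⟨fun j θ h ↦ dottedCircle_not_mem_Olast j θ (h ▸ hν' ⟨_, rfl⟩), fun t h ↦ ?_⟩
  have hmem := (νL (Fin.last k)).apply_mem_compl_range (x := u) hv
  rw [h, ← hLlast] at hmem
  exact hmem ⟨t, rfl⟩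

/-- The picture of a knot point is the virtual point of the knot point (`0 < η`, `|w|² ≥ 4η`).
[folklore] -/
theorem stereoNorthInv_draw_knot (hη : 0 < η) (hKM : ∀ t, K t ∈ modelBoundary k)
    (hKη : ∀ t, 4 * η ≤ ‖wC (K t)‖ ^ 2) (t : 𝕊 1) :
    stereoNorthInv (draw k (K t)) = virtS k η (zC (K t), wC (K t)) ∧
      planarPot k (zC (K t)) ≤ 1 - 4 * η := by
  have hM : (zC (K t), wC (K t)) ∈ Mset k := (mem_Mset_iff _).2 (hKM t)
  have hg : planarPot k (zC (K t)) ≤ 1 - 4 * η := by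
    have := hM.2; simp only at this; linarith [hKη t]
  exact ⟨stereoNorthInv_draw_eq_virtS hη (hKM t) (by linarith), hg⟩

/-- **The virtual point of a point of `M_k ∖ K` off the cores lies in the link complement.**
[folklore] -/
theorem virtS_mem_complement (hη : 0 < η) (hη' : η ≤ 1 / 40) (hKM : ∀ t, K t ∈ modelBoundary k)
    (hKw : ∀ t, wC (K t) ≠ 0) (hKη : ∀ t, 4 * η ≤ ‖wC (K t)‖ ^ 2)
    (hLj : ∀ j : Fin k, ⇑(L.component j.castSucc) = dottedCircle k j)
    (hLlast : ∀ t, L.component (Fin.last k) t = stereoNorthInv (draw k (K t)))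
    {p : ℂ × ℂ} (hp : p ∈ Mset k) (hpK : p ∉ range fun t ↦ (zC (K t), wC (K t))) (hw : p.2 ≠ 0) :
    virtS k η p ∈ L.complement := by
  rw [mem_complement_iff' hLj hLlast]
  have hu : ‖conj (unitDir 0 p.2)‖ = 1 := by rw [Complex.norm_conj, norm_unitDir hw]
  have hre := re_zmod_add_drawRadius_pos hη hη' hp hw
  refine ⟨fun j θ h ↦ ?_, fun t h ↦ ?_⟩
  · rw [dottedCircle_eq_stereoNorthInv_cpt, virtS] at h
    have hc : virtC k η p = cpt k (holeCentre k j) (toC (θ : 𝔼 2)) := stereoNorthInvCoe_injective (by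
      have := congrArg (fun a : 𝕊 3 ↦ (a : 𝔼 4)) h
      simpa only [coe_stereoNorthInv] using this)
    have hk : (0 : ℝ) ≤ k := Nat.cast_nonneg k
    have := fst_eq_of_cpt_eq hu (by rw [norm_toC, norm_eq_of_mem_sphere]) hre.le
      (re_add_drawRadius_pos_of_norm_le ((norm_holeCentre_le (r := k) j).trans (by linarith))).le hc
    exact zmod_ne_holeCentre hη hη' hp hw j this
  · rw [(stereoNorthInv_draw_knot hη hKM hKη t).1] at h
    have hMt : (zC (K t), wC (K t)) ∈ Mset k := (mem_Mset_iff _).2 (hKM t)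
    obtain ⟨h1, h2⟩ := zmod_eq_of_virtS_eq hη hη' hp hMt hw (hKw t) h
    exact hpK ⟨t, (eq_of_zmod_eq hη hη' hp hMt hw (hKw t) h1 h2).symm⟩

/-- **The outer core points of the outer core zone lie in the link complement.** [folklore] -/
theorem outS_mem_complement (hη : 0 < η) (hKM : ∀ t, K t ∈ modelBoundary k) (hKw : ∀ t, wC (K t) ≠ 0)
    (hLj : ∀ j : Fin k, ⇑(L.component j.castSucc) = dottedCircle k j)
    (hLlast : ∀ t, L.component (Fin.last k) t = stereoNorthInv (draw k (K t)))
    {q : ℂ × ℂ} (hq : q ∈ zoneO k η) : outS k q ∈ L.complement := by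
  rw [mem_complement_iff' hLj hLlast]
  have hk : (0 : ℝ) ≤ k := Nat.cast_nonneg k
  refine ⟨fun j θ h ↦ ?_, fun t h ↦ ?_⟩
  · rw [dottedCircle_eq_stereoNorthInv_cpt] at h
    exact outS_ne_stereoNorthInv_cpt hη hq ((norm_holeCentre_le (r := k) j).trans (by linarith))
      (by rw [norm_toC, norm_eq_of_mem_sphere]) h
  · rw [draw_eq_cpt] at h
    have hMt : (zC (K t), wC (K t)) ∈ Mset k := (mem_Mset_iff _).2 (hKM t)
    exact outS_ne_stereoNorthInv_cpt hη hq (norm_fst_le_of_mem hMt)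
      (by rw [Complex.norm_conj, norm_unitDir (hKw t)]) h

variable (νL jA jB fl)

/-- **The gluing data of a surgery presentation with round tubes** (see the module docstring).
[folklore] -/
def gluingOf (hη : 0 < η) (hη' : η ≤ 1 / 40)
    (hKM : ∀ t, K t ∈ modelBoundary k) (hKw : ∀ t, wC (K t) ≠ 0) (hKη : ∀ t, 4 * η ≤ ‖wC (K t)‖ ^ 2)
    (hLj : ∀ j : Fin k, ⇑(L.component j.castSucc) = dottedCircle k j)
    (hLlast : ∀ t, L.component (Fin.last k) t = stereoNorthInv (draw k (K t)))
    (hνj : ∀ (j : Fin k) (q : (𝕊 1) × (𝔼 2)), νL j.castSucc q = dottedTubeFun k j (q.1, flipE (fl j) q.2))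
    (hν' : range (νL (Fin.last k)) ⊆ Olast k η)
    (hA : Manifold.IsSmoothEmbedding (𝓡 3) (𝓡 3) ∞ jA) (hAo : IsOpen (range jA))
    (hB : ∀ i, Manifold.IsSmoothEmbedding (𝓘(ℝ, 𝔼 2).prod (𝓡 1)) (𝓡 3) ∞ (jB i) ∧ IsOpen (range (jB i)))
    (hcov : range jA ∪ (⋃ i, range (jB i)) = univ)
    (hBdisj : Pairwise fun i j ↦ Disjoint (range (jB i)) (range (jB j)))
    (hglue : ∀ i a b, jA a = jB i b ↔ Link.surgeryRel νL i a b) (y₀ : Y) : Gluing k η Y := by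
  classical
  haveI : Nonempty solidTorus := ⟨⟨(0, baseS), by rw [mem_solidTorus_iff, norm_zero]; exact one_pos⟩⟩
  -- a point of the complement: a point of the punctured last tube
  have hhalf : ((1 / 2 : ℝ) • (baseS : 𝔼 2)) ≠ 0 :=
    smul_ne_zero (by norm_num) (ne_zero_of_mem_unit_sphere _)
  haveI : Nonempty L.complement := ⟨⟨_, tubeLast_mem_complement hLj hLlast hν' baseS hhalf⟩⟩
  have hAopen : IsOpenMap jA :=
    Literature.Geometry.Manifold.isOpenMap_of_isSmoothEmbedding_of_isOpen_range hA hAo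
  have hBopen : ∀ i, IsOpenMap (jB i) := fun i ↦
    Literature.Geometry.Manifold.isOpenMap_of_isSmoothEmbedding_of_isOpen_range (hB i).1 (hB i).2
  -- the images of the two kinds of pieces
  have himA : extA jA y₀ '' (L.complement : Set (𝕊 3)) = range jA := by
    ext y
    constructor
    · rintro ⟨a, ha, rfl⟩; exact ⟨⟨a, ha⟩, (extA_of_mem jA y₀ ha).symm⟩
    · rintro ⟨a, rfl⟩; exact ⟨a, a.2, extA_coe jA y₀ a⟩
  have himB : ∀ i, extB (jB i) '' {b : (𝔼 2) × (𝕊 1) | ‖b.1‖ < 1} = range (jB i) := fun i ↦ by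
    ext y
    constructor
    · rintro ⟨b, hb, rfl⟩; exact ⟨_, (extB_of_lt (jB i) hb).symm⟩
    · rintro ⟨b, rfl⟩; exact ⟨b, (mem_solidTorus_iff _).1 b.2, extB_coe (jB i) b⟩
  exact {
    JA := extA jA y₀
    JB := fun i ↦ extB (jB i)
    fl := fl
    LC := (L.complement : Set (𝕊 3))
    JAinv := fun y ↦ ((invFun jA y : L.complement) : 𝕊 3)
    JBinv := fun i y ↦ ((invFun (jB i) y : solidTorus) : (𝔼 2) × (𝕊 1))
    KC := fun t ↦ (zC (K t), wC (K t))
    T' := fun q ↦ νL (Fin.last k) q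
    hη := hη
    hη' := hη'
    isOpen_LC := L.complement.isOpen
    JA_smooth := by
      intro a ha
      have h : ContMDiffAt (𝓡 3) (𝓡 3) ∞ (fun x : L.complement ↦ extA jA y₀ x) ⟨a, ha⟩ := by
        have : (fun x : L.complement ↦ extA jA y₀ x) = jA := funext fun x ↦ extA_coe jA y₀ x
        rw [this]; exact hA.contMDiff.contMDiffAt
      exact (contMDiffAt_subtype_iff.1 h).contMDiffWithinAt
    JB_smooth := by
      intro i b hb
      have h : ContMDiffAt (𝓘(ℝ, 𝔼 2).prod (𝓡 1)) (𝓡 3) ∞ (fun x : solidTorus ↦ extB (jB i) x)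
          ⟨b, (mem_solidTorus_iff b).2 hb⟩ := by
        have : (fun x : solidTorus ↦ extB (jB i) x) = jB i := funext fun x ↦ extB_coe (jB i) x
        rw [this]; exact (hB i).1.contMDiff.contMDiffAt
      exact (contMDiffAt_subtype_iff.1 h).contMDiffWithinAt
    JA_inj := by
      intro a ha a' ha' h
      rw [extA_of_mem jA y₀ ha, extA_of_mem jA y₀ ha'] at h
      exact congrArg Subtype.val (hA.isEmbedding.injective h)
    JB_inj := by
      intro i b hb b' hb' h
      rw [extB_of_lt (jB i) hb, extB_of_lt (jB i) hb'] at h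
      exact congrArg Subtype.val ((hB i).1.isEmbedding.injective h)
    JB_disj := by
      intro i i' b b' hii' hb hb' h
      exact Set.disjoint_left.1 (hBdisj hii') (extB_mem_range (jB i) b) (h ▸ extB_mem_range (jB i') b')
    JA_open := by
      intro U hU hUL
      have : extA jA y₀ '' U = jA '' (Subtype.val ⁻¹' U) := by
        ext y
        constructor
        · rintro ⟨a, ha, rfl⟩; exact ⟨⟨a, hUL ha⟩, ha, (extA_of_mem jA y₀ (hUL ha)).symm⟩
        · rintro ⟨a, ha, rfl⟩; exact ⟨a, ha, extA_coe jA y₀ a⟩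
      rw [this]
      exact hAopen _ (hU.preimage continuous_subtype_val)
    JB_open := by
      intro i U hU hUB
      have : extB (jB i) '' U = jB i '' (Subtype.val ⁻¹' U) := by
        ext y
        constructor
        · rintro ⟨b, hb, rfl⟩
          exact ⟨⟨b, (mem_solidTorus_iff b).2 (hUB hb)⟩, hb, (extB_of_lt (jB i) (hUB hb)).symm⟩
        · rintro ⟨b, hb, rfl⟩; exact ⟨b, hb, extB_coe (jB i) b⟩
      rw [this]
      exact hBopen i _ (hU.preimage continuous_subtype_val)
    JAinv_JA := by
      intro a ha
      show ((invFun jA (extA jA y₀ a) : L.complement) : 𝕊 3) = a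
      rw [extA_of_mem jA y₀ ha, leftInverse_invFun hA.isEmbedding.injective]
    JBinv_JB := by
      intro i b hb
      show ((invFun (jB i) (extB (jB i) b) : solidTorus) : (𝔼 2) × (𝕊 1)) = b
      rw [extB_of_lt (jB i) hb, leftInverse_invFun (hB i).1.isEmbedding.injective]
    JAinv_smooth := by
      rw [himA]
      exact contMDiff_subtype_val.comp_contMDiffOn
        (Literature.Geometry.Manifold.contMDiffOn_invFun_range hA)
    JBinv_smooth := by
      intro i
      rw [himB i]
      exact contMDiff_subtype_val.comp_contMDiffOn
        (Literature.Geometry.Manifold.contMDiffOn_invFun_range (hB i).1)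
    cover := by
      intro y
      have hy : y ∈ range jA ∪ ⋃ i, range (jB i) := by rw [hcov]; trivial
      rcases hy with ⟨a, rfl⟩ | hy
      · exact Or.inl ⟨a, a.2, extA_coe jA y₀ a⟩
      · obtain ⟨i, b, rfl⟩ := mem_iUnion.1 hy
        exact Or.inr ⟨i, b, (mem_solidTorus_iff _).1 b.2, extB_coe (jB i) b⟩
    glueA := by
      intro j a ha b hb
      rw [extA_of_mem jA y₀ ha, extB_of_lt (jB _) hb, hglue]
      show (νL j.castSucc).glueRel a b ↔ _
      have key : ∀ (u : 𝕊 1) (t : ℝ), νL j.castSucc (u, t • (b.2 : 𝔼 2)) =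
          dottedTubeFun k j (u, t • flipE (fl j) (b.2 : 𝔼 2)) := fun u t ↦ by
        rw [hνj]
        exact congrArg (fun v ↦ dottedTubeFun k j (u, v)) (flipE_smul (fl j) t (b.2 : 𝔼 2))
      simp only [Knot.TubularNbhd.glueRel, key]
    glueL := by
      intro a ha b hb
      rw [extA_of_mem jA y₀ ha, extB_of_lt (jB _) hb, hglue]
      rfl
    tubeA_mem := fun j u v hv _ ↦ dottedTubeFun_mem_complement hKM hKw hLj hLlast hνj j u hv
    LC_dotted := by
      intro j θ h
      rw [SetLike.mem_coe, Link.mem_complement_iff] at h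
      exact h j.castSucc ⟨θ, by rw [hLj]⟩
    T'_mem := fun u v hv _ ↦ tubeLast_mem_complement hLj hLlast hν' u hv
    T'_spec := by
      intro u v _
      obtain ⟨hM, hw, hg, hv⟩ := lift_of_mem_Olast hη (hν' ⟨(u, v), rfl⟩)
      exact ⟨_, hM, hw, hg, hv⟩
    T'_zero := by
      intro u
      show νL (Fin.last k) (u, 0) = _
      rw [(νL (Fin.last k)).coe_apply_zero, hLlast, (stereoNorthInv_draw_knot hη hKM hKη u).1]
    KC_mem := fun t ↦ (mem_Mset_iff _).2 (hKM t)
    KC_pot := fun t ↦ (stereoNorthInv_draw_knot hη hKM hKη t).2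
    KC_snd := hKw
    KC_virt := by
      intro t h
      rw [← (stereoNorthInv_draw_knot hη hKM hKη t).1, ← hLlast, SetLike.mem_coe,
        Link.mem_complement_iff] at h
      exact h (Fin.last k) ⟨t, rfl⟩
    virt_mem := fun p hp hpK hw ↦ virtS_mem_complement hη hη' hKM hKw hKη hLj hLlast hp hpK hw
    outS_mem := fun q hq ↦ outS_mem_complement hη hKM hKw hLj hLlast hq }

omit [IsManifold (𝓡 3) ∞ Y] in
/-- The model map of the gluing data is the model map of the extended pieces. [folklore] -/
theorem gluingOf_map (hη : 0 < η) (hη' : η ≤ 1 / 40)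
    (hKM : ∀ t, K t ∈ modelBoundary k) (hKw : ∀ t, wC (K t) ≠ 0) (hKη : ∀ t, 4 * η ≤ ‖wC (K t)‖ ^ 2)
    (hLj : ∀ j : Fin k, ⇑(L.component j.castSucc) = dottedCircle k j)
    (hLlast : ∀ t, L.component (Fin.last k) t = stereoNorthInv (draw k (K t)))
    (hνj : ∀ (j : Fin k) (q : (𝕊 1) × (𝔼 2)), νL j.castSucc q = dottedTubeFun k j (q.1, flipE (fl j) q.2))
    (hν' : range (νL (Fin.last k)) ⊆ Olast k η)
    (hA : Manifold.IsSmoothEmbedding (𝓡 3) (𝓡 3) ∞ jA) (hAo : IsOpen (range jA))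
    (hB : ∀ i, Manifold.IsSmoothEmbedding (𝓘(ℝ, 𝔼 2).prod (𝓡 1)) (𝓡 3) ∞ (jB i) ∧ IsOpen (range (jB i)))
    (hcov : range jA ∪ (⋃ i, range (jB i)) = univ)
    (hBdisj : Pairwise fun i j ↦ Disjoint (range (jB i)) (range (jB j)))
    (hglue : ∀ i a b, jA a = jB i b ↔ Link.surgeryRel νL i a b) (y₀ : Y) :
    (gluingOf νL jA jB fl hη hη' hKM hKw hKη hLj hLlast hνj hν' hA hAo hB hcov hBdisj hglue y₀).map =
      modelMap k η (extA jA y₀) (fun i ↦ extB (jB i)) fl ∧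
    (gluingOf νL jA jB fl hη hη' hKM hKw hKη hLj hLlast hνj hν' hA hAo hB hcov hBdisj hglue y₀).Sset =
      {p | p ∈ Mset k ∧ p ∉ range fun t ↦ (zC (K t), wC (K t))} ∧
    (gluingOf νL jA jB fl hη hη' hKM hKw hKη hLj hLlast hνj hν' hA hAo hB hcov hBdisj hglue y₀).JB =
      (fun i ↦ extB (jB i)) ∧
    (gluingOf νL jA jB fl hη hη' hKM hKw hKη hLj hLlast hνj hν' hA hAo hB hcov hBdisj hglue y₀).T' =
      (fun q ↦ νL (Fin.last k) q) :=
  ⟨rfl, rfl, rfl, rfl⟩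

end Data

end MMSW

end Literature.Topology.FourManifolds
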